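import Summits.KontsevichZagierPeriods.KontsevichZagierPeriods.Theses.HurwitzMicroSectors
import Summits.KontsevichZagierPeriods.KontsevichZagierPeriods.Theorems.HurwitzMicroSectorsNormalFormPrinciplePiBoxTransfer
import Summits.KontsevichZagierPeriods.KontsevichZagierPeriods.Theorems.HurwitzMicroSectorsNormalFormPrincipleVariants2204
import Summits.KontsevichZagierPeriods.KontsevichZagierPeriods.Theorems.HurwitzMicroSectorsNormalFormPrincipleVariants2238
import Summits.KontsevichZagierPeriods.KontsevichZagierPeriods.Theorems.HurwitzMicroSectorsNormalFormPrincipleVariants2261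

/-! TTRL-lite variant V2233 of stmt-KontsevichZagierPeriods-3869

Variant V2233 = `stub_boxRigidity` (the leaf `BoxRigidity` of `NormalFormPrinciple`: two representations
on open unit boxes with integrands of KZ's rational shape `p/q`, `p, q` over `ℚ`, and equal values are
KZ-equivalent) under the TWO-sided small-case move `fix_nat:m=2; bound_nat:m'≤8` (left dimension
frozen to `2`, right dimension `≤ 8`). Verdict of the attempt seat: **open** — this file is the
exact-strength certificate, not a proof of the variant. As for every two-sided sibling
(`…Variants2204/2222/2228/2238/2239/2340/2349/2350`), the strength of a joint bound is that of its
LARGEST dimension, here `8`: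
* `stub_boxRigidity_var2233_iff_boxVanishing_eight`: V2233 ⟺ **BoxVanishing 8** — every box-rational
  representation on `(0,1)⁸` of value `0` is a relation (⇒: the pair `(2, 8)` is allowed, compare with
  the zero representation on the square, `boxVanishingDim_right_of_pair`; ⇐: pad both sides to the
  `8`-box and subtract there, `boxRigidityLe_of_boxVanishingDim`, both from `…Variants2238`);
* `stub_boxRigidity_var2233_iff_pair_two_eight`: already the single pair of dimensions `(2, 8)` is the
  whole variant (the bound `m' ≤ 8` may be frozen to `m' = 8`);
* `stub_boxRigidity_var2233_iff_le_eight`: V2233 ⟺ BoxRigidity with BOTH dimensions `≤ 8` (freezing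
  `m = 2` rather than bounding it loses nothing);
* `stub_boxRigidity_var2228_of_var2233`, `stub_boxRigidity_var2204_of_var2233`,
  `sectorTwo_of_stub_boxRigidity_var2233`, `catalanSector_unconditional_of_stub_boxRigidity_var2233`:
  V2233 contains V2228 (= BoxVanishing 6) and V2204 (= BoxVanishing 2), hence Conjecture 1 on EVERY
  weight-two Hurwitz sector `P(xy)/(1 − (xy)ᴸ)` of the square with NO independence input — in
  particular the level-`4` (Catalan) rung, which the route closes only under the open hypothesis
  `Indep_ℚ(1, π², G)`; BoxVanishing 8 moreover decides every `ℚ`-linear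
  relation among the absolutely convergent `∫_{(0,1)^j} p/q`, `j ≤ 8` (all multiple zeta values of
  weight `≤ 8`, `ζ(3)`, `ζ(5)`, `ζ(7)`, `ζ(3)²` versus `ζ(6)`, `ζ(3)ζ(5)` versus `ζ(8)`, `Li_k` at
  rationals, …) in favour of the four moves — nothing in the tree or in print proves that;
* `stub_boxRigidity_var2233_of_var2261` / `_of_parent` / `_of_statement`: the one-sided sibling V2261
  (`bound_nat:m'≤8`, m free — equivalent to the parent, `…Variants2261`) ⇒ V2233, and
  Summit ⇒ parent ⇒ V2233, so a refutation of the variant would refute Conjecture 1 for the tree's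
  calculus.
Source: M. Kontsevich, D. Zagier, *Periods* (2001), §1.2 Conjecture 1. Pure proof file, no definitions. -/

-- `Summit.<Summit>.<Problem>` is the tree's mandated summit-side namespace (CONVENTIONS §2); for this
-- single-conjunct summit the two coincide, so the duplicate is deliberate.
set_option linter.dupNamespace false

noncomputable section

namespace Summit.KontsevichZagierPeriods.KontsevichZagierPeriods.Theorems

open MeasureTheory Set
open Literature.NumberTheory.Transcendental Literature.NumberTheory.Transcendental.KZ
open Summit.KontsevichZagierPeriods.KontsevichZagierPeriods.Theses.HurwitzMicroSectors
open Summit.KontsevichZagierPeriods.HurwitzMicroSectors.NormalFormPrinciple.PiBox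

/-! ## The variant V2233: Conjecture 1 for box-rational periods of dimension `8` -/

/-- **V2233 ⟺ BoxVanishing in dimension `8`** (every box-rational representation on `(0,1)⁸` of value
`0` is a relation): (⇒) the pair of dimensions `(2, 8)` is allowed, so compare a vanishing box-rational
representation on `(0,1)⁸` with the zero representation on the square (`boxVanishingDim_right_of_pair`);
(⇐) pad both representations to the `8`-box and subtract there (`boxRigidityLe_of_boxVanishingDim 8`
with `m = 2 ≤ 8`, `m' ≤ 8`). [cite: KontsevichZagier2001, §1.2 Conjecture 1] -/
theorem stub_boxRigidity_var2233_iff_boxVanishing_eight :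
    (∀ (m' : ℕ) (N : IntegralRep 2) (N' : IntegralRep m'), m' ≤ 8 → N.domain = {x | ∀ i, x i ∈ Set.Ioo (0:ℝ) 1} → N.IsRational → N'.domain = {x | ∀ i, x i ∈ Set.Ioo (0:ℝ) 1} → N'.IsRational → N.value = N'.value → Equivalent N N') ↔
    (∀ (M : IntegralRep 8), M.domain = {x | ∀ i, x i ∈ Set.Ioo (0:ℝ) 1} → M.IsRational →
      M.value = 0 → of M ∈ relations) :=
  ⟨fun h => boxVanishingDim_right_of_pair 2 8 fun N N' => h 8 N N' le_rfl,
    fun hvan m' N N' hm' => boxRigidityLe_of_boxVanishingDim 8 hvan 2 m' N N' (by norm_num) hm'⟩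

/-- **V2233 ⟺ rigidity for the single pair of dimensions `(2, 8)`**: the bound `m' ≤ 8` may be frozen
to `m' = 8` without loss (both sides are BoxVanishing 8). [cite: KontsevichZagier2001, §1.2 Conjecture 1] -/
theorem stub_boxRigidity_var2233_iff_pair_two_eight :
    (∀ (m' : ℕ) (N : IntegralRep 2) (N' : IntegralRep m'), m' ≤ 8 → N.domain = {x | ∀ i, x i ∈ Set.Ioo (0:ℝ) 1} → N.IsRational → N'.domain = {x | ∀ i, x i ∈ Set.Ioo (0:ℝ) 1} → N'.IsRational → N.value = N'.value → Equivalent N N') ↔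
    (∀ (N : IntegralRep 2) (N' : IntegralRep 8), N.domain = {x | ∀ i, x i ∈ Set.Ioo (0:ℝ) 1} →
      N.IsRational → N'.domain = {x | ∀ i, x i ∈ Set.Ioo (0:ℝ) 1} → N'.IsRational →
      N.value = N'.value → Equivalent N N') := by
  rw [stub_boxRigidity_var2233_iff_boxVanishing_eight]
  exact ⟨fun hvan N N' => boxRigidityLe_of_boxVanishingDim 8 hvan 2 8 N N' (by norm_num) le_rfl,
    fun h => boxVanishingDim_right_of_pair 2 8 h⟩

/-- **V2233 ⟺ BoxRigidity for all dimensions `m, m' ≤ 8`** (so V2233 coincides with every two-sided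
sibling of maximum dimension `8`: `bound_nat:m≤8; bound_nat:m'≤8`, `fix_nat:m'=8; bound_nat:m≤k`, …).
[cite: KontsevichZagier2001, §1.2 Conjecture 1] -/
theorem stub_boxRigidity_var2233_iff_le_eight :
    (∀ (m' : ℕ) (N : IntegralRep 2) (N' : IntegralRep m'), m' ≤ 8 → N.domain = {x | ∀ i, x i ∈ Set.Ioo (0:ℝ) 1} → N.IsRational → N'.domain = {x | ∀ i, x i ∈ Set.Ioo (0:ℝ) 1} → N'.IsRational → N.value = N'.value → Equivalent N N') ↔
    (∀ (m m' : ℕ) (N : IntegralRep m) (N' : IntegralRep m'), m ≤ 8 → m' ≤ 8 →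
      N.domain = {x | ∀ i, x i ∈ Set.Ioo (0:ℝ) 1} → N.IsRational →
      N'.domain = {x | ∀ i, x i ∈ Set.Ioo (0:ℝ) 1} → N'.IsRational →
      N.value = N'.value → Equivalent N N') := by
  rw [stub_boxRigidity_var2233_iff_boxVanishing_eight]
  exact ⟨fun hvan => boxRigidityLe_of_boxVanishingDim 8 hvan,
    fun h => boxVanishingDim_left_of_pair 8 8 fun N N' => h 8 8 N N' le_rfl le_rfl⟩

/-- **V2233 ⇒ BoxVanishing in every dimension `j ≤ 8`** (monotonicity in the dimension, by padding):
in particular the dimension-`3` (`ζ(3)`), dimension-`5` (`ζ(5)`, `ζ(2)ζ(3)`) and dimension-`7`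
(`ζ(7)`, `ζ(2)ζ(5)`, `ζ(3)ζ(4)`) statements. [cite: KontsevichZagier2001, §1.2 Conjecture 1] -/
theorem boxVanishing_le_eight_of_stub_boxRigidity_var2233
    (h : ∀ (m' : ℕ) (N : IntegralRep 2) (N' : IntegralRep m'), m' ≤ 8 → N.domain = {x | ∀ i, x i ∈ Set.Ioo (0:ℝ) 1} → N.IsRational → N'.domain = {x | ∀ i, x i ∈ Set.Ioo (0:ℝ) 1} → N'.IsRational → N.value = N'.value → Equivalent N N')
    {j : ℕ} (hj : j ≤ 8) (N : IntegralRep j) (hNd : N.domain = {x | ∀ i, x i ∈ Set.Ioo (0:ℝ) 1})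
    (hNr : N.IsRational) (hv : N.value = 0) : of N ∈ relations :=
  boxVanishingDim_mono hj (stub_boxRigidity_var2233_iff_boxVanishing_eight.1 h) N hNd hNr hv

/-- **V2233 ⇒ V2228** (`fix_nat:m=2; bound_nat:m'≤6`, i.e. BoxVanishing 6): restrict the right
dimension from `≤ 8` to `≤ 6`. [cite: KontsevichZagier2001, §1.2 Conjecture 1] -/
theorem stub_boxRigidity_var2228_of_var2233
    (h : ∀ (m' : ℕ) (N : IntegralRep 2) (N' : IntegralRep m'), m' ≤ 8 → N.domain = {x | ∀ i, x i ∈ Set.Ioo (0:ℝ) 1} → N.IsRational → N'.domain = {x | ∀ i, x i ∈ Set.Ioo (0:ℝ) 1} → N'.IsRational → N.value = N'.value → Equivalent N N') :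
    ∀ (m' : ℕ) (N : IntegralRep 2) (N' : IntegralRep m'), m' ≤ 6 → N.domain = {x | ∀ i, x i ∈ Set.Ioo (0:ℝ) 1} → N.IsRational → N'.domain = {x | ∀ i, x i ∈ Set.Ioo (0:ℝ) 1} → N'.IsRational → N.value = N'.value → Equivalent N N' :=
  fun m' N N' hm' => h m' N N' (hm'.trans (by norm_num))

/-- **V2233 ⇒ V2204** (`fix_nat:m=2; bound_nat:m'≤2`, i.e. BoxVanishing 2 — the first open
dimension): restrict the right dimension from `≤ 8` to `≤ 2`. [cite: KontsevichZagier2001, §1.2 Conjecture 1] -/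
theorem stub_boxRigidity_var2204_of_var2233
    (h : ∀ (m' : ℕ) (N : IntegralRep 2) (N' : IntegralRep m'), m' ≤ 8 → N.domain = {x | ∀ i, x i ∈ Set.Ioo (0:ℝ) 1} → N.IsRational → N'.domain = {x | ∀ i, x i ∈ Set.Ioo (0:ℝ) 1} → N'.IsRational → N.value = N'.value → Equivalent N N') :
    ∀ (m' : ℕ) (N : IntegralRep 2) (N' : IntegralRep m'), m' ≤ 2 → N.domain = {x | ∀ i, x i ∈ Set.Ioo (0:ℝ) 1} → N.IsRational → N'.domain = {x | ∀ i, x i ∈ Set.Ioo (0:ℝ) 1} → N'.IsRational → N.value = N'.value → Equivalent N N' :=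
  fun m' N N' hm' => h m' N N' (hm'.trans (by norm_num))

/-- **V2233 ⇒ Conjecture 1 on every weight-two Hurwitz sector of the square, unconditionally**: two
representations on `(0,1)²` with integrands `P(xy)/(1 − (xy)ᴸ)`, `P'(xy)/(1 − (xy)ᴸ)` (`L ≠ 0`,
`P, P' ∈ ℚ[t]`) and equal values are KZ-equivalent — via V2204 (`sectorTwo_of_stub_boxRigidity_var2204`);
the route proves the levels `L = 6` (`SectorTwoSix`) and `L = 4` (`CatalanSectorTwoFour`) only under
linear-independence hypotheses. [cite: KontsevichZagier2001, §1.2 Conjecture 1] -/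
theorem sectorTwo_of_stub_boxRigidity_var2233
    (h : ∀ (m' : ℕ) (N : IntegralRep 2) (N' : IntegralRep m'), m' ≤ 8 → N.domain = {x | ∀ i, x i ∈ Set.Ioo (0:ℝ) 1} → N.IsRational → N'.domain = {x | ∀ i, x i ∈ Set.Ioo (0:ℝ) 1} → N'.IsRational → N.value = N'.value → Equivalent N N')
    (L : ℕ) (hL : L ≠ 0) :
    ∀ (r r' : IntegralRep 2) (P P' : Polynomial ℚ), r.domain = {x | ∀ i, x i ∈ Set.Ioo (0:ℝ) 1} →
      r'.domain = {x | ∀ i, x i ∈ Set.Ioo (0:ℝ) 1} →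
      EqOn r.integrand (fun x => Polynomial.aeval (x 0 * x 1) P / (1 - (x 0 * x 1) ^ L)) r.domain →
      EqOn r'.integrand (fun x => Polynomial.aeval (x 0 * x 1) P' / (1 - (x 0 * x 1) ^ L)) r'.domain →
      r.value = r'.value → Equivalent r r' :=
  sectorTwo_of_stub_boxRigidity_var2204 (stub_boxRigidity_var2204_of_var2233 h) L hL

/-- **V2233 ⇒ the Catalan rung unconditionally**: the CONCLUSION of the route item
`CatalanSectorTwoFour` (two representations on `(0,1)²` with integrands `P(xy)/(1 − (xy)⁴)` and equal
values are KZ-equivalent) without its open hypothesis `Indep_ℚ(1, π², G)` — via V2204.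
[cite: KontsevichZagier2001, §1.2 Conjecture 1] -/
theorem catalanSector_unconditional_of_stub_boxRigidity_var2233
    (h : ∀ (m' : ℕ) (N : IntegralRep 2) (N' : IntegralRep m'), m' ≤ 8 → N.domain = {x | ∀ i, x i ∈ Set.Ioo (0:ℝ) 1} → N.IsRational → N'.domain = {x | ∀ i, x i ∈ Set.Ioo (0:ℝ) 1} → N'.IsRational → N.value = N'.value → Equivalent N N') :
    ∀ (r r' : IntegralRep 2) (P P' : Polynomial ℚ), r.domain = {x | ∀ i, x i ∈ Set.Ioo (0:ℝ) 1} →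
      r'.domain = {x | ∀ i, x i ∈ Set.Ioo (0:ℝ) 1} →
      EqOn r.integrand (fun x => Polynomial.aeval (x 0 * x 1) P / (1 - (x 0 * x 1) ^ 4)) r.domain →
      EqOn r'.integrand (fun x => Polynomial.aeval (x 0 * x 1) P' / (1 - (x 0 * x 1) ^ 4)) r'.domain →
      r.value = r'.value → Equivalent r r' :=
  catalanSector_unconditional_of_stub_boxRigidity_var2204 (stub_boxRigidity_var2204_of_var2233 h)

/-- **The one-sided sibling V2261 (`bound_nat:m'≤8`, `m` free) ⇒ V2233** (specialise `m := 2`); V2261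
is equivalent to the whole parent leaf (`stub_boxRigidity_var2261_iff_parent`), V2233 only to its
dimension-`8` fragment. [cite: KontsevichZagier2001, §1.2 Conjecture 1] -/
theorem stub_boxRigidity_var2233_of_var2261
    (h : ∀ (m m' : ℕ) (N : IntegralRep m) (N' : IntegralRep m'), m' ≤ 8 → N.domain = {x | ∀ i, x i ∈ Set.Ioo (0:ℝ) 1} → N.IsRational → N'.domain = {x | ∀ i, x i ∈ Set.Ioo (0:ℝ) 1} → N'.IsRational → N.value = N'.value → Equivalent N N') :
    ∀ (m' : ℕ) (N : IntegralRep 2) (N' : IntegralRep m'), m' ≤ 8 → N.domain = {x | ∀ i, x i ∈ Set.Ioo (0:ℝ) 1} → N.IsRational → N'.domain = {x | ∀ i, x i ∈ Set.Ioo (0:ℝ) 1} → N'.IsRational → N.value = N'.value → Equivalent N N' :=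
  h 2

/-- **The parent leaf ⇒ V2233** (the variant is a specialisation of `stub_boxRigidity`; the converse is
not claimed — the parent is BoxVanishing in ALL dimensions). [cite: KontsevichZagier2001, §1.2 Conjecture 1] -/
theorem stub_boxRigidity_var2233_of_parent
    (h : ∀ (m m' : ℕ) (N : IntegralRep m) (N' : IntegralRep m'), N.domain = {x | ∀ i, x i ∈ Set.Ioo (0:ℝ) 1} → N.IsRational → N'.domain = {x | ∀ i, x i ∈ Set.Ioo (0:ℝ) 1} → N'.IsRational → N.value = N'.value → Equivalent N N') :
    ∀ (m' : ℕ) (N : IntegralRep 2) (N' : IntegralRep m'), m' ≤ 8 → N.domain = {x | ∀ i, x i ∈ Set.Ioo (0:ℝ) 1} → N.IsRational → N'.domain = {x | ∀ i, x i ∈ Set.Ioo (0:ℝ) 1} → N'.IsRational → N.value = N'.value → Equivalent N N' :=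
  stub_boxRigidity_var2233_of_var2261 (stub_boxRigidity_var2261_iff_parent.2 h)

/-- **`KontsevichZagierPeriods ⇒ V2233`**: the variant is a special case of Conjecture 1 for the
tree's calculus (`leaves_of_statement`) — so a refutation of the variant would refute the Summit.
[cite: KontsevichZagier2001, §1.2 Conjecture 1] -/
theorem stub_boxRigidity_var2233_of_statement (h : _root_.KontsevichZagierPeriods) :
    ∀ (m' : ℕ) (N : IntegralRep 2) (N' : IntegralRep m'), m' ≤ 8 → N.domain = {x | ∀ i, x i ∈ Set.Ioo (0:ℝ) 1} → N.IsRational → N'.domain = {x | ∀ i, x i ∈ Set.Ioo (0:ℝ) 1} → N'.IsRational → N.value = N'.value → Equivalent N N' :=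
  stub_boxRigidity_var2233_of_parent (leaves_of_statement h).1

end Summit.KontsevichZagierPeriods.KontsevichZagierPeriods.Theorems

end
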